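import Literature.Analysis.InnerProduct.HigherLensSpaceMultiplicity
import Literature.Analysis.InnerProduct.LensSpaceSpectrum
import Mathlib.RingTheory.PowerSeries.Inverse
import Mathlib.RingTheory.PowerSeries.WellKnown
import Mathlib.Algebra.Order.Antidiag.Finsupp
import Mathlib.Algebra.BigOperators.Field
import HarnessLib

/-!
# The spectrum of the lens spaces `L(q; p₁, …, p_n) = S^{2n−1}/G` of every dimension: `dim E_{k(k+2n−2)} = dim H_k^G =
# (1/q)∑_l (χ_k − χ_{k−2})(g^l)`, Ikeda–Yamamoto's Theorem 3.2 / Ikeda's generating function (2.3)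
# `F_q(z : p₁, …, p_n) = (1/q)∑_{l<q} (1 − z²)/∏ᵢ(1 − γ^{pᵢl}z)(1 − γ^{−pᵢl}z)` in `ℝ⟦z⟧`, and the isospectrality criterion (2.2)

Layer `Literature/Analysis/InnerProduct`, namespace `Literature.Analysis.InnerProduct`; lane `lit-hodgefound`, prover seat
`lit-hodgefound-p06`, generation 44, self-proposed row g44-#2. The DEFINITIONS are row g44-#1 `HigherLensSpaceMultiplicity.lean`
(imported): `sphereMonomialCharacter n k c` (`χ_k` of `P_k(ℂ^n)` on the torus, as a polynomial function of `cᵢ = cos φᵢ`),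
`sphereHarmonicCharacter` (`χ̃_k = χ_k − χ_{k−2}`), `lensSpaceMonomialCount q p k` (`dim P_k^G`), `lensSpaceMultiplicity q p k`
(`dim E_{k(k+2n−2)} = dim H_k^G`). THIS file PROVES their printed properties for EVERY number `n` of weights — the three-dimensional
case `n = 2` being the tree's `LensSpaceSpectrum.lean` (whose one-variable tools `quadratic_mul_mk_U_eval`, `eval_U_cos_eq_sum_cos`,
`sum_range_cos_two_pi_mul_div` are REUSED, and to whose definitions §5 proves ours specialise). THEOREMS ONLY (no definition, no
instance, no notation, no named fact). Row g44-#3 `IkedaIsospectralLensSpaces.lean` builds Ikeda's isospectral non-isometric lens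
spaces on §4.

## Sources, verbatim

A. Ikeda, Y. Yamamoto, *On the spectra of 3-dimensional lens spaces*, Osaka J. Math. **16** (1979) 447–469 (held text
`paper:doi-10-18910-4811`), §2 (p0005–p0006): "**Proposition 2.1.** The space `H_k` is `U(n+1)`-invariant, and the `U(n+1)`-module
`P_k` has the direct sum decomposition; `P_k = H_k ⊕ r²P_{k−2}`. … **Proposition 2.2.** `ℋ_k` is an eigenspace of `Δ` on `S^{2n+1}`
with eigenvalue `k(k+2n)` … **Corollary 2.3.** Let `L(q : p₀, ⋯, p_n)` be a lens space and `ℋ_k^G` the space of all `G`-invariant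
functions in `ℋ_k` where `G = {g^k}_{k=0,1,…,q−1}`. Then we have `dim E_{k(k+2n)} = dim ℋ_k^G`. Moreover, for any integer `k` such
that `dim ℋ_k^G ≠ 0`, `k(k+2n)` is an eigenvalue of `Δ` on `L(q : p₀, ⋯, p_n)` with multiplicity `dim ℋ_k^G` and no other
eigenvalues appear in the spectrum of `Δ`." §3 (p0006–p0007): "Let `χ_k` (resp. `χ̃_k`) be the character of the `G`-module `P_k`
(resp. `H_k`). Then by Proposition 2.1, we have (3.1) `χ̃_k = χ_k − χ_{k−2}`, where `χ_{−t} = 0` for `t > 0`, since `r²` is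
invariant by `G`. The space `P_k` has a base consisting of all monomials of the form (3.2) `z^I·z̄^J` … Let `g` be the generator
of `G` and `γ = exp 2π√−1/q`. Then for any monomial `z^I·z̄^J`, we have (3.3) `g(z^I·z̄^J) = γ^{i₀p₀+⋯+i_np_n−j₀p₀−⋯−j_np_n}
z^I·z̄^J`. Consider the formal expansion of (3.4) `∏_{i=0}^{n}(1 − γ^{p_il}z)^{−1}(1 − γ^{−p_il}z)^{−1}`. Then it is easy to see
that `χ_k(g^l)` is equal to the `z^k`'s coefficient of (3.4). … **Theorem 3.2.** … `F(z)` has the following form on the domain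
`{z ∈ ℂ : |z| < 1}` (3.8) `F(z) = (1/q)∑_{l=0}^{q−1}(1−z²)/∏_{i=0}^{n}(z−γ^{p_il})(z−γ^{−p_il})`. *Proof.* By Corollary 2.3, we have
(3.9) `F(z) = ∑_{k=0}^∞(dim ℋ_k^G)z^k`. On the other hand by Proposition 2.2 and (3.1), we have (3.10) `dim ℋ_k^G =
(1/q)∑_{l=0}^{q−1}(χ_k(g^l) − χ_{k−2}(g^l))`. Note that, for a nontrivial irreducible representation of `G`, the sum `∑_{g∈G}χ(g)`
of its character is zero."
A. Ikeda, *On lens spaces which are isospectral but not isometric*, Ann. Sci. ÉNS (4) **13** (1980) 303–315 (held text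
`paper:doi-10-24033-asens-1384`), §2 (p0008–p0009): "Let `Δ` be the Laplacian acting on the space of smooth functions on `L(q : p₁,
…, p_n)`. Then each eigenvalue of `Δ` is of the form `k(k+2n−2)` (`k = 0, 1, 2, …`). We denote by `E_{k(k+2n−2)}` the eigenspace of
`Δ` with eigenvalue `k(k+2n−2)`. … (2.1) `F_q(z : p₁, …, p_n) = ∑_{k=0}^∞(dim E_{k(k+2n−2)})z^k`. First note (2.2) The lens space
`L(q : p₁, …, p_n)` is isospectral to `L(q : s₁, …, s_n)` if and only if their generating functions are identical (see [6]). And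
next, we observe that the generating function is a meromorphic function and more strongly it is a rational function; (2.3) `F_q(z :
p₁, …, p_n) = (1/q)∑_{l=1}^{q}(1−z²)/∏_{i=1}^{n}(z−γ^{p_il})(z−γ^{−p_il})` where `γ` is a primitive `q`-th root of `1`."

## The dictionary and what is proved

One factor of (3.4) at `e^{iφ}` is `(1 − e^{iφ}z)^{−1}(1 − e^{−iφ}z)^{−1} = (1 − 2cos φ·z + z²)^{−1} = ∑_j U_j(cos φ)zʲ` and `(z − γ^{pl})
(z − γ^{−pl}) = z² − 2cos(2πpl/q)z + 1 = 1 − 2cos(2πpl/q)z + z²` (palindromic), so everything is stated in `ℝ⟦z⟧` with the real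
quadratics `1 − 2cᵢz + z²`, `cᵢ = cos(2πlpᵢ/q)`, which have constant term `1` and are therefore invertible in `ℝ⟦z⟧`.
* §1 **`mk_sphereMonomialCharacter`** (`∑_kχ_kz^k = ∏ᵢ∑_jU_j(cᵢ)zʲ`, via `PowerSeries.coeff_prod` re-indexed by `antidiagonalTuple`),
  **`prod_quadratic_mul_mk_sphereMonomialCharacter`** (`∏ᵢ(1−2cᵢz+z²)·∑χ_kz^k = 1`), `mk_sphereHarmonicCharacter`,
  **`prod_quadratic_mul_mk_sphereHarmonicCharacter`** (THEOREM 3.2 / (2.3) TERMWISE, EVERY `n`: `∏ᵢ(1−2cᵢz+z²)·∑χ̃_kz^k = 1 − z²`),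
  `mk_sphereMonomialCharacter_eq_inv`, `mk_sphereHarmonicCharacter_eq_inv` (the same with `(∏ᵢ(1−2cᵢz+z²))^{−1}`).
* §2 `eval_U_cos_eq_sum_antidiagonal_cos / _exp` (`U_m(cos φ) = ∑_{a+b=m}e^{i(a−b)φ}`), **`sphereMonomialCharacter_cos_eq_sum_exp`**,
  **`sphereMonomialCharacter_cos`** (`χ_k(cos φ) = ∑_{|I|+|J|=k}cos(∑(Iᵢ−Jᵢ)φᵢ)`: `χ_k` IS the trace on the monomial basis (3.2)–(3.3)).
* §3 **`sum_range_sphereMonomialCharacter`** (`∑_{l<q}χ_k(g^l) = q·dim P_k^G`, orthogonality in `ℤ/q`),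
  **`lensSpaceMonomialCount_le_add_two`** (`dim P_k^G ≤ dim P_{k+2}^G` by `z₁z̄₁·`, an explicit injection), `cast_lensSpaceMultiplicity`,
  **`lensSpaceMultiplicity_eq_sum_sphereHarmonicCharacter`** (THE MULTIPLICITY FORMULA (3.10) IN EVERY DIMENSION).
* §4 **`mk_lensSpaceMultiplicity`** (IKEDA'S (2.3): `∑_k dim E_{k(k+2n−2)}z^k = (1/q)∑_{l<q}(1−z²)(∏ᵢ(1−2cos(2πlpᵢ/q)z+z²))^{−1}`),
  **`lensSpaceMultiplicity_eq_iff`** (THE ISOSPECTRALITY CRITERION (2.2): same multiplicities for all `k` iff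
  `∑_{l<q}(∏ᵢ(1−2cos(2πlpᵢ/q)z+z²))^{−1}` agree in `ℝ⟦z⟧`).
* §5 `n = 2` is the three-dimensional case: **`sphereMonomialCharacter_two`**, `sphereHarmonicCharacter_two`, **`lensSpaceMonomialCount_two`**,
  **`lensSpaceMultiplicity_two`** (`= threeSphereMonomialCharacter`, …, `lensMultiplicity` of `LensSpaceMultiplicity.lean`); `n = 1`,
  the circle: `sphereHarmonicCharacter_one` (`χ̃_k = 2T_k`, `k ≥ 1`).
* §6 `q = 1`, the sphere `S^{2n+1}` itself: **`lensSpaceMonomialCount_one_left`** (`dim P_k = C(k+2n+1, 2n+1)`, via `∏ᵢ∑_j(j+1)zʲ =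
  (1−z)^{−(2n+2)}`, Mathlib's `mk_one_pow_eq_mk_choose_add`), **`lensSpaceMultiplicity_one_left`** (`dim H_k(S^{2n+1}) = C(k+2n+1,2n+1) −
  C(k+2n−1,2n+1)`, the multiplicity of `k(k+2n)` on the round sphere as in `OddSphereHeatTraceExpansion.lean`).
Statements needing `dim P_{k−2}^G ≤ dim P_k^G` are stated for `n + 1` weights (`p : Fin (n+1) → ℤ`); for `n = 0` there is no sphere.

## References

* [IkedaYamamoto1979] A. Ikeda, Y. Yamamoto, *On the spectra of 3-dimensional lens spaces*, Osaka J. Math. 16 (1979) 447–469,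
  Propositions 2.1–2.2, Corollary 2.3, §3 (3.1)–(3.5), Theorem 3.2 (3.8)–(3.10).
* [Ikeda1980] A. Ikeda, *On lens spaces which are isospectral but not isometric*, Ann. Sci. ÉNS (4) 13 (1980) 303–315, §2 (2.1)–(2.3).
-/

noncomputable section

open Finset Polynomial.Chebyshev PowerSeries

namespace Literature.Analysis.InnerProduct

open _root_.Real

/-! ### §1 The generating function `∑_k χ_k(c)z^k = ∏ᵢ ∑_j U_j(cᵢ)zʲ = ∏ᵢ (1 − 2cᵢz + z²)^{−1}` -/

/-- Coefficients of a finite product of power series indexed by `Fin n`, as a sum over `antidiagonalTuple n k`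
(Mathlib's `PowerSeries.coeff_prod` re-indexed from `finsuppAntidiag univ k`). [folklore] -/
private theorem coeff_prod_mk_eq_sum_antidiagonalTuple {R : Type*} [CommSemiring R] {n : ℕ} (f : Fin n → ℕ → R) (k : ℕ) :
    coeff k (∏ i, PowerSeries.mk (f i)) = ∑ x ∈ Finset.Nat.antidiagonalTuple n k, ∏ i, f i (x i) := by
  rw [coeff_prod]
  refine Finset.sum_equiv Finsupp.equivFunOnFinite (fun l ↦ ?_) (fun l _ ↦ ?_)
  · rw [mem_finsuppAntidiag, Finset.Nat.mem_antidiagonalTuple]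
    simp [Finsupp.equivFunOnFinite]
  · simp [Finsupp.equivFunOnFinite, coeff_mk]

/-- **`∑_k χ_k(c)z^k = ∏ᵢ(∑_j U_j(cᵢ)zʲ)`** in `ℝ⟦z⟧` — "`χ_k(g^l)` is equal to the `z^k`'s coefficient of (3.4)" with one factor
`(1 − γ^{pl}z)^{−1}(1 − γ^{−pl}z)^{−1} = ∑_j U_j(cos(2πpl/q))zʲ`. [cite: IkedaYamamoto1979, §3 (3.4)] -/
theorem mk_sphereMonomialCharacter {n : ℕ} (c : Fin n → ℝ) :
    PowerSeries.mk (fun k ↦ sphereMonomialCharacter n k c) = ∏ i, PowerSeries.mk (fun j : ℕ ↦ (U ℝ j).eval (c i)) := by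
  ext k
  rw [coeff_mk, coeff_prod_mk_eq_sum_antidiagonalTuple]
  rfl

/-- **`∏ᵢ(1 − 2cᵢz + z²) · ∑_k χ_k(c)z^k = 1`** in `ℝ⟦z⟧`: `∑_k χ_k z^k = ∏ᵢ(1 − 2cᵢz + z²)^{−1}` ((3.4) for `n` factors).
[cite: IkedaYamamoto1979, §3 (3.4)] -/
theorem prod_quadratic_mul_mk_sphereMonomialCharacter {n : ℕ} (c : Fin n → ℝ) :
    (∏ i, ((1 : ℝ⟦X⟧) - PowerSeries.C (2 * c i) * X + X ^ 2)) * PowerSeries.mk (fun k ↦ sphereMonomialCharacter n k c) = 1 := by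
  rw [mk_sphereMonomialCharacter, ← Finset.prod_mul_distrib]
  exact Finset.prod_eq_one fun i _ ↦ quadratic_mul_mk_U_eval (c i)

/-- `(χ̃_k : ℝ) = χ_k − [k ≥ 2]χ_{k−2}`, all `k`. [cite: IkedaYamamoto1979, §3 (3.1)] -/
theorem sphereHarmonicCharacter_eq (n k : ℕ) (c : Fin n → ℝ) :
    sphereHarmonicCharacter n k c =
      sphereMonomialCharacter n k c - (if 2 ≤ k then sphereMonomialCharacter n (k - 2) c else 0) := rfl

/-- `∑_k χ̃_k z^k = (1 − z²)·∑_k χ_k z^k`. [cite: IkedaYamamoto1979, §3 (3.1)] -/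
theorem mk_sphereHarmonicCharacter {n : ℕ} (c : Fin n → ℝ) :
    PowerSeries.mk (fun k ↦ sphereHarmonicCharacter n k c) =
      ((1 : ℝ⟦X⟧) - X ^ 2) * PowerSeries.mk (fun k ↦ sphereMonomialCharacter n k c) := by
  ext k
  rw [coeff_mk, sub_mul, one_mul, map_sub, coeff_mk, coeff_X_pow_mul', sphereHarmonicCharacter_eq]
  split_ifs <;> simp [coeff_mk]

/-- **IKEDA–YAMAMOTO'S THEOREM 3.2 / IKEDA'S (2.3) TERM BY TERM, EVERY DIMENSION: `∏ᵢ(1 − 2cᵢz + z²) · ∑_k χ̃_k(c)z^k = 1 − z²`**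
in `ℝ⟦z⟧`, i.e. `∑_k(χ_k(g^l) − χ_{k−2}(g^l))z^k = (1 − z²)/∏ᵢ(1 − γ^{pᵢl}z)(1 − γ^{−pᵢl}z)`; averaging over `l` gives
`F_q(z : p₁, …, p_n) = (1/q)∑_l (1 − z²)/∏ᵢ(z − γ^{pᵢl})(z − γ^{−pᵢl})` (`mk_lensSpaceMultiplicity`). [cite: IkedaYamamoto1979, Theorem
3.2 (3.8)–(3.10); Ikeda1980, §2 (2.3)] -/
theorem prod_quadratic_mul_mk_sphereHarmonicCharacter {n : ℕ} (c : Fin n → ℝ) :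
    (∏ i, ((1 : ℝ⟦X⟧) - PowerSeries.C (2 * c i) * X + X ^ 2)) * PowerSeries.mk (fun k ↦ sphereHarmonicCharacter n k c) =
      1 - X ^ 2 := by
  rw [mk_sphereHarmonicCharacter, mul_left_comm, prod_quadratic_mul_mk_sphereMonomialCharacter, mul_one]

/-- The constant term of `∏ᵢ(1 − 2cᵢz + z²)` is `1` (so the product is invertible in `ℝ⟦z⟧`). [folklore] -/
private theorem constantCoeff_prod_quadratic {n : ℕ} (c : Fin n → ℝ) :
    constantCoeff (∏ i, ((1 : ℝ⟦X⟧) - PowerSeries.C (2 * c i) * X + X ^ 2)) = 1 := by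
  rw [map_prod]
  refine Finset.prod_eq_one fun i _ ↦ ?_
  simp

/-- **`∑_k χ_k(c)z^k = (∏ᵢ(1 − 2cᵢz + z²))^{−1}`** in `ℝ⟦z⟧`. [cite: IkedaYamamoto1979, §3 (3.4)] -/
theorem mk_sphereMonomialCharacter_eq_inv {n : ℕ} (c : Fin n → ℝ) :
    PowerSeries.mk (fun k ↦ sphereMonomialCharacter n k c) = (∏ i, ((1 : ℝ⟦X⟧) - PowerSeries.C (2 * c i) * X + X ^ 2))⁻¹ := by
  rw [PowerSeries.eq_inv_iff_mul_eq_one (by rw [constantCoeff_prod_quadratic]; exact one_ne_zero), mul_comm]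
  exact prod_quadratic_mul_mk_sphereMonomialCharacter c

/-- **`∑_k χ̃_k(c)z^k = (1 − z²)·(∏ᵢ(1 − 2cᵢz + z²))^{−1}`** in `ℝ⟦z⟧`. [cite: IkedaYamamoto1979, Theorem 3.2 (3.8); Ikeda1980, §2
(2.3)] -/
theorem mk_sphereHarmonicCharacter_eq_inv {n : ℕ} (c : Fin n → ℝ) :
    PowerSeries.mk (fun k ↦ sphereHarmonicCharacter n k c) =
      ((1 : ℝ⟦X⟧) - X ^ 2) * (∏ i, ((1 : ℝ⟦X⟧) - PowerSeries.C (2 * c i) * X + X ^ 2))⁻¹ := by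
  rw [mk_sphereHarmonicCharacter, mk_sphereMonomialCharacter_eq_inv]

/-! ### §2 `χ_k` is the trace on the monomial basis: `χ_k(cos φ₁, …, cos φ_n) = ∑_{|I|+|J|=k} cos⟨I − J, φ⟩` -/

/-- `U_m(cos φ) = ∑_{a+b=m} cos((a−b)φ)` (the weights of the monomials `z^az̄^b`). [cite: IkedaYamamoto1979, §3 (3.3)–(3.4)] -/
theorem eval_U_cos_eq_sum_antidiagonal_cos (m : ℕ) (φ : ℝ) :
    (U ℝ m).eval (Real.cos φ) = ∑ ab ∈ antidiagonal m, Real.cos (((ab.1 : ℝ) - ab.2) * φ) := by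
  rw [eval_U_cos_eq_sum_cos, Finset.Nat.sum_antidiagonal_eq_sum_range_succ_mk]
  refine Finset.sum_congr rfl fun j hj ↦ ?_
  have hj' : j ≤ m := Nat.lt_succ_iff.mp (Finset.mem_range.mp hj)
  dsimp only
  rw [Nat.cast_sub hj', ← Real.cos_neg]
  congr 1
  ring

/-- `∑_{a+b=m} sin((a−b)φ) = 0` (the weights `a − b` and `b − a` pair off). [folklore] -/
private theorem sum_antidiagonal_sin_eq_zero (m : ℕ) (φ : ℝ) :
    ∑ ab ∈ antidiagonal m, Real.sin (((ab.1 : ℝ) - ab.2) * φ) = 0 := by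
  have h : ∑ ab ∈ antidiagonal m, Real.sin (((ab.1 : ℝ) - ab.2) * φ) =
      ∑ ab ∈ antidiagonal m, Real.sin (((ab.2 : ℝ) - ab.1) * φ) := by
    conv_rhs => rw [← Finset.HasAntidiagonal.map_swap_antidiagonal, Finset.sum_map]
    rfl
  have h' : ∑ ab ∈ antidiagonal m, Real.sin (((ab.2 : ℝ) - ab.1) * φ) =
      -∑ ab ∈ antidiagonal m, Real.sin (((ab.1 : ℝ) - ab.2) * φ) := by
    rw [← Finset.sum_neg_distrib]
    refine Finset.sum_congr rfl fun ab _ ↦ ?_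
    rw [← Real.sin_neg]
    congr 1
    ring
  linarith

/-- `U_m(cos φ) = ∑_{a+b=m} e^{i(a−b)φ}` as a complex number: the character of the monomials `z^az̄^b`, `a + b = m`, at `e^{iφ}`.
[cite: IkedaYamamoto1979, §3 (3.3)–(3.4)] -/
theorem eval_U_cos_eq_sum_antidiagonal_exp (m : ℕ) (φ : ℝ) :
    (((U ℝ m).eval (Real.cos φ) : ℝ) : ℂ) =
      ∑ ab ∈ antidiagonal m, Complex.exp (((((ab.1 : ℝ) - ab.2) * φ : ℝ) : ℂ) * Complex.I) := by
  have hre := eval_U_cos_eq_sum_antidiagonal_cos m φ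
  have him := sum_antidiagonal_sin_eq_zero m φ
  apply Complex.ext
  · rw [Complex.ofReal_re, Complex.re_sum, hre]
    exact Finset.sum_congr rfl fun ab _ ↦ (Complex.exp_ofReal_mul_I_re _).symm
  · rw [Complex.ofReal_im, Complex.im_sum]
    symm
    rw [← him]
    exact Finset.sum_congr rfl fun ab _ ↦ Complex.exp_ofReal_mul_I_im _

/-- **`χ_k` IS THE CHARACTER OF `P_k` ON THE MONOMIAL BASIS (complex form): `χ_k(cos φ₁, …, cos φ_n) = ∑_{|I|+|J|=k} e^{i∑ᵢ(Iᵢ−Jᵢ)φᵢ}`**,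
the monomials indexed by `xᵢ = Iᵢ + Jᵢ` (`∑xᵢ = k`) and `(Iᵢ, Jᵢ) ∈ antidiagonal xᵢ` ("`g(z^I·z̄^J) = γ^{i₀p₀+⋯−j₀p₀−⋯}z^I·z̄^J`").
[cite: IkedaYamamoto1979, §3 (3.2)–(3.4)] -/
theorem sphereMonomialCharacter_cos_eq_sum_exp {n : ℕ} (k : ℕ) (φ : Fin n → ℝ) :
    ((sphereMonomialCharacter n k (fun i ↦ Real.cos (φ i)) : ℝ) : ℂ) =
      ∑ x ∈ Finset.Nat.antidiagonalTuple n k, ∑ e ∈ Fintype.piFinset (fun i ↦ antidiagonal (x i)),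
        Complex.exp (((∑ i, (((e i).1 : ℝ) - (e i).2) * φ i : ℝ) : ℂ) * Complex.I) := by
  unfold sphereMonomialCharacter
  rw [Complex.ofReal_sum]
  refine Finset.sum_congr rfl fun x _ ↦ ?_
  rw [Complex.ofReal_prod]
  simp_rw [eval_U_cos_eq_sum_antidiagonal_exp]
  rw [Finset.prod_univ_sum]
  refine Finset.sum_congr rfl fun e _ ↦ ?_
  rw [← Complex.exp_sum]
  congr 1
  push_cast
  rw [Finset.sum_mul]

/-- **`χ_k` IS THE CHARACTER OF `P_k` ON THE MONOMIAL BASIS: `χ_k(cos φ₁, …, cos φ_n) = ∑_{|I|+|J|=k} cos(∑ᵢ(Iᵢ−Jᵢ)φᵢ)`**.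
[cite: IkedaYamamoto1979, §3 (3.2)–(3.4)] -/
theorem sphereMonomialCharacter_cos {n : ℕ} (k : ℕ) (φ : Fin n → ℝ) :
    sphereMonomialCharacter n k (fun i ↦ Real.cos (φ i)) =
      ∑ x ∈ Finset.Nat.antidiagonalTuple n k, ∑ e ∈ Fintype.piFinset (fun i ↦ antidiagonal (x i)),
        Real.cos (∑ i, (((e i).1 : ℝ) - (e i).2) * φ i) := by
  have h := congrArg Complex.re (sphereMonomialCharacter_cos_eq_sum_exp k φ)
  rw [Complex.ofReal_re] at h
  rw [h, Complex.re_sum]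
  refine Finset.sum_congr rfl fun x _ ↦ ?_
  rw [Complex.re_sum]
  exact Finset.sum_congr rfl fun e _ ↦ Complex.exp_ofReal_mul_I_re _

/-! ### §3 Character orthogonality and the multiplicity formula (3.10) for every `n` -/

/-- **`∑_{l<q} χ_k(g^l) = q·dim P_k^G`** for `L(q; p₁, …, p_n)` (`g^l = diag(γ^{lp₁}, …, γ^{lp_n})`, `γ = e^{2πi/q}`): the monomial
`z^Iz̄^J` contributes `∑_l γ^{l∑(Iᵢ−Jᵢ)pᵢ} = q·[q ∣ ∑(Iᵢ−Jᵢ)pᵢ]`. [cite: IkedaYamamoto1979, §3 (3.3) and the proof of Theorem 3.2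
("for a nontrivial irreducible representation of `G`, the sum `∑χ(g)` of its character is zero")] -/
theorem sum_range_sphereMonomialCharacter {n : ℕ} (q : ℕ) (hq : q ≠ 0) (p : Fin n → ℤ) (k : ℕ) :
    ∑ l ∈ range q, sphereMonomialCharacter n k (fun i ↦ Real.cos (2 * π * l * p i / q)) =
      (q : ℝ) * lensSpaceMonomialCount q p k := by
  simp_rw [sphereMonomialCharacter_cos]
  rw [Finset.sum_comm]
  unfold lensSpaceMonomialCount
  push_cast
  rw [Finset.mul_sum]
  refine Finset.sum_congr rfl fun x _ ↦ ?_
  rw [Finset.sum_comm, Finset.mul_sum]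
  refine Finset.sum_congr rfl fun e _ ↦ ?_
  have he : ∀ l : ℕ, Real.cos (∑ i, (((e i).1 : ℝ) - (e i).2) * (2 * π * l * p i / q)) =
      Real.cos (2 * π * l * ((∑ i, (((e i).1 : ℤ) - (e i).2) * p i : ℤ) : ℝ) / q) := by
    intro l
    congr 1
    push_cast
    rw [Finset.mul_sum, Finset.sum_div]
    refine Finset.sum_congr rfl fun i _ ↦ ?_
    ring
  simp_rw [he]
  rw [sum_range_cos_two_pi_mul_div q hq]
  split_ifs <;> simp

/-- **`dim P_k^G ≤ dim P_{k+2}^G`** (`n ≥ 1`): multiplication by `z₁z̄₁`, `(I₁, J₁) ↦ (I₁+1, J₁+1)`, injects the invariant monomials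
of degree `k` into those of degree `k + 2` (same weight `∑(Iᵢ−Jᵢ)pᵢ`). [cite: IkedaYamamoto1979, Proposition 2.1 (`P_k = H_k ⊕ r²P_{k−2}`)] -/
theorem lensSpaceMonomialCount_le_add_two {n : ℕ} (q : ℕ) (p : Fin (n + 1) → ℤ) (k : ℕ) :
    lensSpaceMonomialCount q p k ≤ lensSpaceMonomialCount q p (k + 2) := by
  classical
  -- write both counts as cardinalities of finsets of pairs `(x, e)`
  set S : ℕ → Finset (Σ _ : Fin (n + 1) → ℕ, Fin (n + 1) → ℕ × ℕ) := fun m ↦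
    (Finset.Nat.antidiagonalTuple (n + 1) m).sigma fun x ↦
      (Fintype.piFinset (fun i ↦ antidiagonal (x i))).filter
        (fun e ↦ (q : ℤ) ∣ ∑ i, (((e i).1 : ℤ) - (e i).2) * p i) with hS
  have hcount : ∀ m, lensSpaceMonomialCount q p m = (S m).card := by
    intro m
    rw [hS, Finset.card_sigma]
    unfold lensSpaceMonomialCount
    refine Finset.sum_congr rfl fun x _ ↦ ?_
    rw [Finset.card_filter]
  rw [hcount, hcount]
  -- the injection `(x, e) ↦ (x + 2δ₀, e + (1,1)δ₀)`
  let F : (Σ _ : Fin (n + 1) → ℕ, Fin (n + 1) → ℕ × ℕ) → (Σ _ : Fin (n + 1) → ℕ, Fin (n + 1) → ℕ × ℕ) := fun xe ↦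
    ⟨Function.update xe.1 0 (xe.1 0 + 2), Function.update xe.2 0 ((xe.2 0).1 + 1, (xe.2 0).2 + 1)⟩
  refine Finset.card_le_card_of_injOn F (fun xe hxe ↦ ?_) (fun xe _ xe' _ h ↦ ?_)
  · -- maps `S k` into `S (k+2)`
    obtain ⟨x, e⟩ := xe
    simp only [hS, F, Finset.mem_coe, Finset.mem_sigma, Finset.mem_filter, Fintype.mem_piFinset, Finset.Nat.mem_antidiagonalTuple,
      mem_antidiagonal] at hxe ⊢
    obtain ⟨hx, he, hdvd⟩ := hxe
    refine ⟨?_, fun i ↦ ?_, ?_⟩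
    · rw [Fin.sum_univ_succ] at hx
      rw [Fin.sum_univ_succ, Function.update_self]
      simp only [Function.update_of_ne (Fin.succ_ne_zero _)]
      omega
    · by_cases hi : i = 0
      · subst hi
        simp only [Function.update_self]
        have := he 0
        omega
      · simp only [Function.update_of_ne hi]
        exact he i
    · have e2 : ∑ i, ((((Function.update e 0 ((e 0).1 + 1, (e 0).2 + 1) i).1 : ℤ)) -
          (Function.update e 0 ((e 0).1 + 1, (e 0).2 + 1) i).2) * p i = ∑ i, (((e i).1 : ℤ) - (e i).2) * p i := by
        refine Finset.sum_congr rfl fun i _ ↦ ?_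
        by_cases hi : i = 0
        · subst hi
          simp only [Function.update_self]
          push_cast
          ring
        · simp only [Function.update_of_ne hi]
      rw [e2]
      exact hdvd
  · -- injective
    obtain ⟨x, e⟩ := xe
    obtain ⟨x', e'⟩ := xe'
    simp only [F, Sigma.mk.injEq] at h
    obtain ⟨h1, h2⟩ := h
    have hx : x = x' := by
      funext i
      by_cases hi : i = 0
      · subst hi
        have := congrFun h1 0
        simp only [Function.update_self] at this
        omega
      · have := congrFun h1 i
        simpa only [Function.update_of_ne hi] using this
    subst hx
    simp only [heq_eq_eq] at h2
    have hee : e = e' := by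
      funext i
      by_cases hi : i = 0
      · subst hi
        have := congrFun h2 0
        simp only [Function.update_self, Prod.mk.injEq] at this
        exact Prod.ext (by omega) (by omega)
      · have := congrFun h2 i
        simpa only [Function.update_of_ne hi] using this
    subst hee
    rfl

/-- `dim H_{k+2}^G = dim P_{k+2}^G − dim P_k^G` (truncated subtraction in `ℕ`). [cite: IkedaYamamoto1979, §3 (3.1), (3.10)] -/
theorem lensSpaceMultiplicity_add_two {n : ℕ} (q : ℕ) (p : Fin n → ℤ) (k : ℕ) :
    lensSpaceMultiplicity q p (k + 2) = lensSpaceMonomialCount q p (k + 2) - lensSpaceMonomialCount q p k := by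
  rw [lensSpaceMultiplicity, if_pos (by omega), Nat.add_sub_cancel]

/-- `(dim H_k^G : ℝ) = dim P_k^G − dim P_{k−2}^G` with `dim P_{−1}^G = dim P_{−2}^G = 0`, all `k` (`n ≥ 1`). [cite: IkedaYamamoto1979,
§3 (3.1), (3.10)] -/
theorem cast_lensSpaceMultiplicity {n : ℕ} (q : ℕ) (p : Fin (n + 1) → ℤ) (k : ℕ) :
    (lensSpaceMultiplicity q p k : ℝ) =
      (lensSpaceMonomialCount q p k : ℝ) - (if 2 ≤ k then (lensSpaceMonomialCount q p (k - 2) : ℝ) else 0) := by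
  rcases k with _ | _ | k
  · simp [lensSpaceMultiplicity]
  · simp [lensSpaceMultiplicity]
  · rw [lensSpaceMultiplicity_add_two, Nat.cast_sub (lensSpaceMonomialCount_le_add_two q p k), if_pos (by omega),
      show k + 1 + 1 - 2 = k by omega]

/-- **THE MULTIPLICITY FORMULA (3.10) IN EVERY DIMENSION: `dim E_{k(k+2n−2)}(L(q;p₁,…,p_n)) = dim H_k^G =
(1/q)∑_{l=0}^{q−1}(χ_k(g^l) − χ_{k−2}(g^l))`** with `χ_k(g^l) − χ_{k−2}(g^l) = χ̃_k(cos(2πlp₁/q), …, cos(2πlp_n/q))`.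
[cite: IkedaYamamoto1979, Corollary 2.3 and §3 (3.10)] -/
theorem lensSpaceMultiplicity_eq_sum_sphereHarmonicCharacter {n : ℕ} (q : ℕ) (hq : q ≠ 0) (p : Fin (n + 1) → ℤ) (k : ℕ) :
    (lensSpaceMultiplicity q p k : ℝ) =
      1 / q * ∑ l ∈ range q, sphereHarmonicCharacter (n + 1) k (fun i ↦ Real.cos (2 * π * l * p i / q)) := by
  have hq' : (q : ℝ) ≠ 0 := Nat.cast_ne_zero.mpr hq
  rw [cast_lensSpaceMultiplicity]
  simp_rw [sphereHarmonicCharacter_eq]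
  rw [Finset.sum_sub_distrib, sum_range_sphereMonomialCharacter q hq]
  split_ifs with hk
  · rw [sum_range_sphereMonomialCharacter q hq]
    field_simp
  · simp only [Finset.sum_const_zero, sub_zero]
    field_simp

/-! ### §4 Ikeda's generating function `F_q(z : p₁, …, p_n) = (1/q)∑_{l<q}(1 − z²)/∏ᵢ(1 − γ^{pᵢl}z)(1 − γ^{−pᵢl}z)` in `ℝ⟦z⟧`
### and the isospectrality criterion (2.2) -/

/-- **IKEDA'S GENERATING FUNCTION (2.3) / IKEDA–YAMAMOTO'S THEOREM 3.2 IN EVERY DIMENSION, in `ℝ⟦z⟧`: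
`∑_k dim E_{k(k+2n−2)} z^k = (1/q)·∑_{l=0}^{q−1} (1 − z²)·(∏ᵢ(1 − 2cos(2πlpᵢ/q)z + z²))^{−1}`** (`(1 − γ^{pl}z)(1 − γ^{−pl}z) =
1 − 2cos(2πpl/q)z + z²`). [cite: Ikeda1980, §2 (2.1)–(2.3); IkedaYamamoto1979, Theorem 3.2 (3.8)–(3.10)] -/
theorem mk_lensSpaceMultiplicity {n : ℕ} (q : ℕ) (hq : q ≠ 0) (p : Fin (n + 1) → ℤ) :
    PowerSeries.mk (fun k ↦ (lensSpaceMultiplicity q p k : ℝ)) =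
      (1 / (q : ℝ)) • ∑ l ∈ range q, ((1 : ℝ⟦X⟧) - X ^ 2) *
        (∏ i, ((1 : ℝ⟦X⟧) - PowerSeries.C (2 * Real.cos (2 * π * l * p i / q)) * X + X ^ 2))⁻¹ := by
  ext k
  rw [coeff_mk, lensSpaceMultiplicity_eq_sum_sphereHarmonicCharacter q hq, PowerSeries.coeff_smul, map_sum, smul_eq_mul]
  congr 1
  refine Finset.sum_congr rfl fun l _ ↦ ?_
  rw [← mk_sphereHarmonicCharacter_eq_inv, coeff_mk]

/-- `1 − z²` is not a zero divisor of `ℝ⟦z⟧`. [folklore] -/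
private theorem one_sub_X_sq_ne_zero : ((1 : ℝ⟦X⟧) - X ^ 2) ≠ 0 := by
  intro h
  have := congrArg (coeff 0) h
  simp at this

/-- **THE ISOSPECTRALITY CRITERION (2.2) IN `ℝ⟦z⟧`: `L(q : p₁, …, p_n)` and `L(q : s₁, …, s_n)` have the same spectrum
(`dim E_{k(k+2n−2)}` agree for all `k`) if and only if `∑_{l<q}(∏ᵢ(1 − 2cos(2πlpᵢ/q)z + z²))^{−1} = ∑_{l<q}(∏ᵢ(1 −
2cos(2πlsᵢ/q)z + z²))^{−1}`** ("The lens space `L(q : p₁, …, p_n)` is isospectral to `L(q : s₁, …, s_n)` if and only if their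
generating functions are identical"). [cite: Ikeda1980, §2 (2.2)–(2.3)] -/
theorem lensSpaceMultiplicity_eq_iff {n : ℕ} (q : ℕ) (hq : q ≠ 0) (p s : Fin (n + 1) → ℤ) :
    (∀ k, lensSpaceMultiplicity q p k = lensSpaceMultiplicity q s k) ↔
      ∑ l ∈ range q, (∏ i, ((1 : ℝ⟦X⟧) - PowerSeries.C (2 * Real.cos (2 * π * l * p i / q)) * X + X ^ 2))⁻¹ =
        ∑ l ∈ range q, (∏ i, ((1 : ℝ⟦X⟧) - PowerSeries.C (2 * Real.cos (2 * π * l * s i / q)) * X + X ^ 2))⁻¹ := by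
  have hq' : (1 / (q : ℝ)) ≠ 0 := one_div_ne_zero (Nat.cast_ne_zero.mpr hq)
  have hmk : (∀ k, lensSpaceMultiplicity q p k = lensSpaceMultiplicity q s k) ↔
      PowerSeries.mk (fun k ↦ (lensSpaceMultiplicity q p k : ℝ)) = PowerSeries.mk (fun k ↦ (lensSpaceMultiplicity q s k : ℝ)) := by
    rw [PowerSeries.ext_iff]
    simp only [coeff_mk, Nat.cast_inj]
  rw [hmk, mk_lensSpaceMultiplicity q hq p, mk_lensSpaceMultiplicity q hq s, ← Finset.mul_sum, ← Finset.mul_sum]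
  constructor
  · intro h
    exact mul_left_cancel₀ one_sub_X_sq_ne_zero (smul_right_injective _ hq' h)
  · intro h
    rw [h]

/-! ### §5 Consistency with the three-dimensional definitions (`n = 2`) and the circle (`n = 1`) -/

/-- Sums over `piFinset t` for `t : Fin 2 → Finset α` are double sums. [folklore] -/
private theorem sum_piFinset_fin_two {α β : Type*} [AddCommMonoid β] (t : Fin 2 → Finset α) (g : (Fin 2 → α) → β) :
    ∑ e ∈ Fintype.piFinset t, g e = ∑ a ∈ t 0, ∑ b ∈ t 1, g ![a, b] := by
  classical
  rw [← Finset.sum_product']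
  refine Finset.sum_equiv (piFinTwoEquiv fun _ ↦ α) (fun e ↦ ?_) (fun e _ ↦ ?_)
  · simp [Fintype.mem_piFinset, Fin.forall_fin_two]
  · congr 1
    ext i
    fin_cases i <;> rfl

/-- **`n = 2` is the three-dimensional case of the tree**: `χ_k^{(2)}(c₁, c₂) = threeSphereMonomialCharacter k c₁ c₂`.
[cite: IkedaYamamoto1979, §3 (3.4)–(3.5)] -/
theorem sphereMonomialCharacter_two (k : ℕ) (c₁ c₂ : ℝ) :
    sphereMonomialCharacter 2 k ![c₁, c₂] = threeSphereMonomialCharacter k c₁ c₂ := by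
  rw [sphereMonomialCharacter, threeSphereMonomialCharacter, Finset.Nat.antidiagonalTuple_two, Finset.sum_map]
  refine Finset.sum_congr rfl fun ij _ ↦ ?_
  simp [Fin.prod_univ_two]

/-- `χ̃_k^{(2)}(c₁, c₂) = threeSphereHarmonicCharacter k c₁ c₂`. [cite: IkedaYamamoto1979, §3 (3.1)] -/
theorem sphereHarmonicCharacter_two (k : ℕ) (c₁ c₂ : ℝ) :
    sphereHarmonicCharacter 2 k ![c₁, c₂] = threeSphereHarmonicCharacter k c₁ c₂ := by
  rw [sphereHarmonicCharacter, threeSphereHarmonicCharacter, sphereMonomialCharacter_two]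
  split_ifs <;> simp [sphereMonomialCharacter_two]

/-- **`n = 2`: `dim P_k^G` of `L(q; p₁, p₂)` is the tree's `lensMonomialCount q p₁ p₂ k`**. [cite: IkedaYamamoto1979, §3 (3.2)–(3.3)] -/
theorem lensSpaceMonomialCount_two (q : ℕ) (p₁ p₂ : ℤ) (k : ℕ) :
    lensSpaceMonomialCount q ![p₁, p₂] k = lensMonomialCount q p₁ p₂ k := by
  rw [lensSpaceMonomialCount, lensMonomialCount, Finset.Nat.antidiagonalTuple_two, Finset.sum_map]
  refine Finset.sum_congr rfl fun ij _ ↦ ?_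
  rw [show (fun i ↦ antidiagonal (((piFinTwoEquiv fun _ ↦ ℕ).symm.toEmbedding ij) i)) = ![antidiagonal ij.1, antidiagonal ij.2] by
    ext i x; fin_cases i <;> simp, sum_piFinset_fin_two]
  refine Finset.sum_congr rfl fun ab _ ↦ Finset.sum_congr rfl fun cd _ ↦ ?_
  simp [Fin.sum_univ_two]

/-- **`n = 2`: `dim E_{k(k+2)}(L(q; p₁, p₂))` is the tree's `lensMultiplicity q p₁ p₂ k`** (so every three-dimensional result of
`LensSpaceSpectrum.lean` … `LensSpaceOneNormLattice.lean` is the case `n = 2` of the present file). [cite: IkedaYamamoto1979, Corollary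
2.3, §3 (3.1), (3.10)] -/
theorem lensSpaceMultiplicity_two (q : ℕ) (p₁ p₂ : ℤ) (k : ℕ) :
    lensSpaceMultiplicity q ![p₁, p₂] k = lensMultiplicity q p₁ p₂ k := by
  rw [lensSpaceMultiplicity, lensMultiplicity, lensSpaceMonomialCount_two]
  split_ifs <;> simp [lensSpaceMonomialCount_two]

/-- **`n = 1`, the circle `S¹ ⊂ ℂ`**: `χ_k^{(1)}(c) = U_k(c)` and `χ̃_k^{(1)}(c) = U_k(c) − U_{k−2}(c) = 2T_k(c)` for `k ≥ 1`
(`= 2cos kφ` at `c = cos φ`: the two eigenfunctions `e^{±ikθ}` of `−d²/dθ²` for `k² = k(k+2n−2)`, `n = 1`), `χ̃_0 = 1`.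
[cite: IkedaYamamoto1979, Proposition 2.1 and §3 (3.1), (3.4)] -/
theorem sphereHarmonicCharacter_one (k : ℕ) (c : ℝ) :
    sphereHarmonicCharacter 1 k ![c] = if k = 0 then 1 else 2 * (T ℝ k).eval c := by
  have hmon : ∀ m : ℕ, sphereMonomialCharacter 1 m ![c] = (U ℝ m).eval c := by
    intro m
    simp [sphereMonomialCharacter]
  rw [sphereHarmonicCharacter, hmon]
  rcases k with _ | _ | k
  · simp
  · simp
  · rw [if_pos (by omega), if_neg (by omega), hmon, show k + 1 + 1 - 2 = k by omega]
    have h := congrArg (Polynomial.eval c) (two_mul_T_eq_U_sub_U ℝ (k : ℤ))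
    simp only [Polynomial.eval_mul, Polynomial.eval_ofNat, Polynomial.eval_sub] at h
    have e : ((k + 1 + 1 : ℕ) : ℤ) = (k : ℤ) + 2 := by push_cast; ring
    rw [e]
    linarith

/-! ### §6 Sanity `q = 1`: the sphere `S^{2n+1}` itself — `dim P_k = C(k+2n+1, 2n+1)`, `dim H_k = C(k+2n+1,2n+1) − C(k+2n−1,2n+1)` -/

/-- **`q = 1` (no quotient): `dim P_k(ℂ^{n+1}) = C(k + 2n + 1, 2n + 1)`**, the number of all monomials of degree `k` in the `2n + 2`
real variables `zᵢ, z̄ᵢ` (`∏ᵢ ∑_j (j+1)zʲ = (1 − z)^{−(2n+2)}`). [cite: IkedaYamamoto1979, §3 (3.2)] -/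
theorem lensSpaceMonomialCount_one_left {n : ℕ} (p : Fin (n + 1) → ℤ) (k : ℕ) :
    lensSpaceMonomialCount 1 p k = Nat.choose (k + 2 * n + 1) (2 * n + 1) := by
  have h1 : lensSpaceMonomialCount 1 p k = ∑ x ∈ Finset.Nat.antidiagonalTuple (n + 1) k, ∏ i, (x i + 1) := by
    unfold lensSpaceMonomialCount
    refine Finset.sum_congr rfl fun x _ ↦ ?_
    simp only [Nat.cast_one, one_dvd, if_true, Finset.sum_const, smul_eq_mul, mul_one, Fintype.card_piFinset,
      Finset.Nat.card_antidiagonal]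
  have h2 : (PowerSeries.mk (fun j : ℕ ↦ (j : ℝ) + 1) : ℝ⟦X⟧) = (PowerSeries.mk 1) ^ (1 + 1) := by
    rw [mk_one_pow_eq_mk_choose_add]
    congr 1
    funext j
    rw [Nat.choose_one_right]
    push_cast
    ring
  have h3 : ((lensSpaceMonomialCount 1 p k : ℕ) : ℝ) = (Nat.choose (k + 2 * n + 1) (2 * n + 1) : ℝ) := by
    rw [h1]
    push_cast
    rw [← coeff_prod_mk_eq_sum_antidiagonalTuple (R := ℝ) (fun _ j ↦ (j : ℝ) + 1) k, Finset.prod_const, Finset.card_univ,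
      Fintype.card_fin, h2, ← pow_mul, show (1 + 1) * (n + 1) = (2 * n + 1) + 1 by ring, mk_one_pow_eq_mk_choose_add, coeff_mk,
      show 2 * n + 1 + k = k + 2 * n + 1 by ring]
  exact_mod_cast h3

/-- **`q = 1`: `dim H_k(S^{2n+1}) = C(k+2n+1, 2n+1) − C(k+2n−1, 2n+1)`** (`= C(k+2n, 2n) + C(k+2n−1, 2n) =
(2k+2n)(k+2n−1)!/(k!(2n)!)`, the multiplicity of `k(k+2n)` on the round sphere, `OddSphereHeatTraceExpansion.lean`), from `P_k = H_k ⊕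
r²P_{k−2}` (for `k < 2` the subtracted binomial coefficient vanishes). [cite: IkedaYamamoto1979, Propositions 2.1–2.2 and Corollary 2.3
(`q = 1`)] -/
theorem lensSpaceMultiplicity_one_left {n : ℕ} (p : Fin (n + 1) → ℤ) (k : ℕ) :
    lensSpaceMultiplicity 1 p k = Nat.choose (k + 2 * n + 1) (2 * n + 1) - Nat.choose (k + 2 * n - 1) (2 * n + 1) := by
  rw [lensSpaceMultiplicity, lensSpaceMonomialCount_one_left]
  rcases k with _ | _ | k
  · rw [if_neg (by omega), Nat.sub_zero, Nat.choose_eq_zero_of_lt (show 0 + 2 * n - 1 < 2 * n + 1 by omega), Nat.sub_zero]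
  · rw [if_neg (by omega), Nat.sub_zero, Nat.choose_eq_zero_of_lt (show 1 + 2 * n - 1 < 2 * n + 1 by omega), Nat.sub_zero]
  · rw [if_pos (by omega), show k + 1 + 1 - 2 = k by omega, lensSpaceMonomialCount_one_left,
      show k + 1 + 1 + 2 * n - 1 = k + 2 * n + 1 by omega]

end Literature.Analysis.InnerProduct
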